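import Summits.KontsevichZagierPeriods.Zeta5Search.Certificates.TwoTaleTelescopeBR

/-!
# (bmiss)@Ω — cert-2's certificate atoms of direction `b`, side `R`, evaluated in the lattice variable
(cell `pub-zeta5`, cert-1 gen 4)

HONEST FRAMING: systematic search; recurrence certificates; no irrationality claim unless certified. Pure algebra over `ℚ`.

The kernel identity `Certificates.TwoTaleTelescope.telescope_b_R` is stated over opaque atoms `lprod <list> a b e f g t`
(products of integer linear forms) and `polyTN xBR s …` (the packed certificate numerator). The second-tale instance
(`TwoTaleOmega/StepBR`) keeps these atoms OPAQUE in the one big identity and only needs their values at `t = u/2`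
(`u` the lattice variable) as small separate facts — this file: `numBR•_eval`, `denBR•_eval`, `tnBR_eval`, `tdBR_eval`,
`cnumBR_eval`, `cnumSBR_eval`, `cdenBR_eval`, `cdenSBR_eval`, and `xBR_eval : x_R = (g−b−1)(g+b−a−1)`.
-/

open Summit.KontsevichZagierPeriods.Zeta5Search.Certificates.TwoTaleTelescope

namespace Summit.KontsevichZagierPeriods.Zeta5Search.TwoTaleOmega

/-- The certificate numerator `x_R = (g−b−1)(g+b−a−1)` of direction `b` (cert-2's packed `xBR`, any shift `s`). -/
theorem xBR_eval (s : ℤ) (a b e f g t : ℚ) : polyTN xBR s a b e f g t = (g - b - 1) * (g + b - a - 1) := by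
  simp [polyTN, xBR, spvalC, spvalN, spval, unpackT]; ring

/-! ### cert-2's atoms of direction `b`, side `R`, evaluated at `t = u/2` -/

/-- Value of cert-2's atom `lprod numBR1` at `t = u/2`. -/
theorem numBR1_eval (a b e f g u : ℚ) : lprod numBR1 a b e f g (u / 2) = (-b + g - 1) * (a - b + u / 2) := by
  simp only [lprod_cons, lprod_nil, lval, numBR1, List.getD_cons_zero, List.getD_cons_succ]
  push_cast; ring

/-- Value of cert-2's atom `lprod denBR1` at `t = u/2`. -/
theorem denBR1_eval (a b e f g u : ℚ) : lprod denBR1 a b e f g (u / 2) = (a - b + g + u - 1) := by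
  simp only [lprod_cons, lprod_nil, lval, denBR1, List.getD_cons_zero, List.getD_cons_succ]
  push_cast; ring

/-- Value of cert-2's atom `lprod numBR2` at `t = u/2`. -/
theorem numBR2_eval (a b e f g u : ℚ) : lprod numBR2 a b e f g (u / 2) = (-b + g - 1) * (-b + g - 2) * (a - b + u / 2) * (a - b + u / 2 - 1) := by
  simp only [lprod_cons, lprod_nil, lval, numBR2, List.getD_cons_zero, List.getD_cons_succ]
  push_cast; ring

/-- Value of cert-2's atom `lprod denBR2` at `t = u/2`. -/
theorem denBR2_eval (a b e f g u : ℚ) : lprod denBR2 a b e f g (u / 2) = (a - b + g + u - 1) * (a - b + g + u - 2) := by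
  simp only [lprod_cons, lprod_nil, lval, denBR2, List.getD_cons_zero, List.getD_cons_succ]
  push_cast; ring

/-- Value of cert-2's atom `lprod numBR3` at `t = u/2`. -/
theorem numBR3_eval (a b e f g u : ℚ) : lprod numBR3 a b e f g (u / 2) = (-b + g - 1) * (-b + g - 2) * (-b + g - 3) * (a - b + u / 2) * (a - b + u / 2 - 1) * (a - b + u / 2 - 2) := by
  simp only [lprod_cons, lprod_nil, lval, numBR3, List.getD_cons_zero, List.getD_cons_succ]
  push_cast; ring

/-- Value of cert-2's atom `lprod denBR3` at `t = u/2`. -/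
theorem denBR3_eval (a b e f g u : ℚ) : lprod denBR3 a b e f g (u / 2) = (a - b + g + u - 1) * (a - b + g + u - 2) * (a - b + g + u - 3) := by
  simp only [lprod_cons, lprod_nil, lval, denBR3, List.getD_cons_zero, List.getD_cons_succ]
  push_cast; ring

/-- Value of cert-2's atom `lprod tnBR` at `t = u/2`. -/
theorem tnBR_eval (a b e f g u : ℚ) : lprod tnBR a b e f g (u / 2) = (a - b + g + u) * (a - b + g + u + 1) * (a + u / 2) * (e + u / 2) * (f + u / 2) := by
  simp only [lprod_cons, lprod_nil, lval, tnBR, List.getD_cons_zero, List.getD_cons_succ]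
  push_cast; ring

/-- Value of cert-2's atom `lprod tdBR` at `t = u/2`. -/
theorem tdBR_eval (a b e f g u : ℚ) : lprod tdBR a b e f g (u / 2) = (a + u + 1) * (a + u + 2) * (a - b + u / 2 + 1) * (e + f + u / 2) * (g + u / 2) := by
  simp only [lprod_cons, lprod_nil, lval, tdBR, List.getD_cons_zero, List.getD_cons_succ]
  push_cast; ring

/-- Value of cert-2's atom `lprod cnumBR` at `t = u/2`. -/
theorem cnumBR_eval (a b e f g u : ℚ) : lprod cnumBR a b e f g (u / 2) = (a + u - 1) * (a + u) * (a - b + u / 2) * (e + f + u / 2 - 1) * (g + u / 2 - 1) := by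
  simp only [lprod_cons, lprod_nil, lval, cnumBR, List.getD_cons_zero, List.getD_cons_succ]
  push_cast; ring

/-- Value of cert-2's atom `lprod cnumSBR` at `t = u/2`. -/
theorem cnumSBR_eval (a b e f g u : ℚ) : lprod cnumSBR a b e f g (u / 2) = (a + u + 1) * (a + u + 2) * (a - b + u / 2 + 1) * (e + f + u / 2) * (g + u / 2) := by
  simp only [lprod_cons, lprod_nil, lval, cnumSBR, List.getD_cons_zero, List.getD_cons_succ]
  push_cast; ring

/-- Value of cert-2's atom `lprod cdenBR` at `t = u/2`. -/
theorem cdenBR_eval (a b e f g u : ℚ) : lprod cdenBR a b e f g (u / 2) = (a - b + g + u - 1) * (a - b + g + u - 2) * (a - b + g + u - 3) := by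
  simp only [lprod_cons, lprod_nil, lval, cdenBR, List.getD_cons_zero, List.getD_cons_succ]
  push_cast; ring

/-- Value of cert-2's atom `lprod cdenSBR` at `t = u/2`. -/
theorem cdenSBR_eval (a b e f g u : ℚ) : lprod cdenSBR a b e f g (u / 2) = (a - b + g + u + 1) * (a - b + g + u) * (a - b + g + u - 1) := by
  simp only [lprod_cons, lprod_nil, lval, cdenSBR, List.getD_cons_zero, List.getD_cons_succ]
  push_cast; ring


end Summit.KontsevichZagierPeriods.Zeta5Search.TwoTaleOmega
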